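import Literature.AlgebraicGeometry.Motives.GaloisThickeningQuotient
import Mathlib.GroupTheory.NoncommCoprod
import HarnessLib

/-!
# The product action of `Aut(L ∕ K) × G` on the Galois thickening `R_L X` of a `K`-scheme with a `G`-action

Topic `Literature/AlgebraicGeometry/Motives`, namespace `Literature.AlgebraicGeometry.Motives`.  Two plumbing `def`s (`thickeningMapAut`,
`thickeningProdAction`) and theorems; no named fact, no instance, no notation, no `sorry`.  Sequel of ★ `Motives/GaloisThickening` (the
thickening `R_L X = (X ⊗_K L → Spec L → Spec K)`, `thickeningGalAction`, `thickeningπ`, `thickeningLift`) and ★ `Motives/GaloisThickeningQuotient`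
(`isGeometricQuotient_thickeningπ`).  Cell `hodgecm-mathlib`, P6 «MOD programme», organ GAL-4 of the sub-line
`Cruxes/HLiu418/Lines/F0_P6a_ModuliDatum.lean` ED. 2 (desk F0P6a-plan (g0), census `F0/P6/F0P6a-plan/ED2-CENSUS-P6a.v1.F0P6a-plan-g0.md` §1:
«`τ : ActionOver Y.hom (Γ × G)`, `τ (γ, g) := thickeningGalAction γ ≫ R_L (σ_G g)` … the product with `R_L(σ_G)` commutes by naturality of the
twist (organ GAL-4, S)»).  HC_CM is proved only modulo the printed citations until rung 0 closes; nothing here is about HC.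

THE MATHEMATICS.  Let `L ∕ K` be a field extension, `X` a `K`-scheme and `ρ : G → Aut_K(X)` an action of a group `G` on `X` by `K`-automorphisms.
The thickening functor `R_L` carries `ρ` to an action `R_L ∘ ρ` of `G` on `R_L X = X ×_K Spec L` (`thickeningMapAut`), which COMMUTES with the
Galois twists `1 × Spec σ` because the twist is natural in `X` (`thickTwist_comp_map_left`: both are base changes, [GortzWedhorn2020] §(4.8)–(4.9),
(14.20)).  Hence `Aut(L ∕ K) × G` acts on `R_L X` over `Spec K` (`thickeningProdAction`, Mathlib `MonoidHom.noncommCoprod`), and: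
* the `Aut(L ∕ K)`-part (restriction along `inl`) IS the Galois action (`thickeningProdAction_aut_comp_inl`), so for `L ∕ K` finite Galois
  `π_X : R_L X → X` is a geometric quotient by it ([MumfordAV1970] §7 Thm. p. 66; `isGeometricQuotient_inl_thickeningProdAction`, in the literal
  shape of the binder `_hτπ` of the P6a letter UP);
* the `G`-part covers `ρ` through `π_X`: `τ(1, g) ≫ π_X = π_X ≫ ρ(g)` (`thickeningProdAction_inr_comp_π`, the shape of UP's `_hτT`);
* on `Ω`-points, `τ(γ, g) · ℓ_e P = ℓ_{e ∘ γ⁻¹} (ρ(g) · P)` (`map_thickeningProdAction_thickeningLift`): `G` acts inside each sheet, `Aut(L ∕ K)`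
  permutes the sheets.

CONSUMER.  With `X := M⋆_{Kc}`, `ρ := σ_G` (★ `RecordSystemGS.exists_levelQuotientAction`), `L := Fᵢ`, the GEO layer of UP reads
`(Y, π, Γ, τ, _hτπ, _hτT, ℓ, _hℓ) := (R_{Fᵢ} M⋆_{Kc}, thickeningπ, Fᵢ ≃ₐ[F] Fᵢ, thickeningProdAction _ σ_G, isGeometricQuotient_inl_thickeningProdAction,
thickeningProdAction_inr_comp_π, thickeningLift e, map_thickeningπ_thickeningLift)`.

Mathlib searched (pin): `Functor.mapAut`, `MonoidHom.noncommCoprod` (`_apply`, `_comp_inl`, `_comp_inr`), `Aut.Aut_mul_def`, `pullback.hom_ext`,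
`pullback.lift_fst`∕`_snd` (all used).

## References
* [GortzWedhorn2020] U. Görtz, T. Wedhorn, *Algebraic Geometry I* (2nd ed. 2020), §(4.8)–(4.9), (14.20).
* [MumfordAV1970] D. Mumford, *Abelian Varieties* (1970), §7, Theorem p. 66.
* [SGA1] A. Grothendieck, *SGA 1*, Exp. V, §1, Prop. 1.8.
-/

set_option autoImplicit false

noncomputable section

-- `(ρ.aut g).hom` with `ρ.aut g : Aut _`, and `((thickening K L).map f).left` against `pullback.fst _ _`, are only type-correct after
-- unfolding `Aut` ∕ the `abbrev`s (as in ★ `RelativeSpec/FiniteGroupQuotientGluing`, ★ `Motives/IntegralModelOfGlobalModel`).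
set_option backward.isDefEq.respectTransparency false

open CategoryTheory AlgebraicGeometry Limits

universe u

namespace Literature.AlgebraicGeometry.Motives

open Literature.AlgebraicGeometry.RelativeSpec
open Literature.AlgebraicGeometry.Motives.AbelianVariety (bcSpec)

variable {K L : Type u} [Field K] [Field L] [Algebra K L]

/-! ## §1 The thickening on morphisms and the naturality of the Galois twists -/

/-- The underlying morphism of `R_L f` against the first projections: `R_L f ≫ pr₁ = pr₁ ≫ f`. [cite: GortzWedhorn2020, §(4.8)–(4.9)] -/
@[reassoc]
theorem thickening_map_left_comp_fst {X Y : SchemeOver K} (f : X ⟶ Y) :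
    ((thickening K L).map f).left ≫ pullback.fst Y.hom (bcSpec K L) = pullback.fst X.hom (bcSpec K L) ≫ f.left :=
  pullback.lift_fst _ _ _

/-- The underlying morphism of `R_L f` against the second projections: `R_L f ≫ pr₂ = pr₂`. [cite: GortzWedhorn2020, §(4.8)–(4.9)] -/
@[reassoc]
theorem thickening_map_left_comp_snd {X Y : SchemeOver K} (f : X ⟶ Y) :
    ((thickening K L).map f).left ≫ pullback.snd Y.hom (bcSpec K L) = pullback.snd X.hom (bcSpec K L) :=
  pullback.lift_snd _ _ _

/-- **The Galois twist is natural in `X`**: `(1 × Spec σ) ≫ R_L f = R_L f ≫ (1 × Spec σ)` (both are `f × Spec σ`).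
[cite: GortzWedhorn2020, (14.20)] -/
@[reassoc]
theorem thickTwist_comp_map_left {X Y : SchemeOver K} (f : X ⟶ Y) (σ : L ≃ₐ[K] L) :
    thickTwist X σ ≫ ((thickening K L).map f).left = ((thickening K L).map f).left ≫ thickTwist Y σ := by
  apply pullback.hom_ext
  · rw [Category.assoc, thickening_map_left_comp_fst, thickTwist_fst_assoc, Category.assoc, thickTwist_fst,
      thickening_map_left_comp_fst]
  · rw [Category.assoc, thickening_map_left_comp_snd, thickTwist_snd, Category.assoc, thickTwist_snd, ← Category.assoc,
      thickening_map_left_comp_snd]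

/-- **`R_L` on automorphisms**: the group homomorphism `Aut_K(X) → Aut(X ×_K Spec L)`, `f ↦ (R_L f).left` (Mathlib `Functor.mapAut` of the
thickening functor followed by the forgetful functor to schemes). [cite: GortzWedhorn2020, §(4.8)–(4.9)] -/
def thickeningMapAut (X : SchemeOver K) : Aut X →* Aut ((thickening K L).obj X).left :=
  ((Over.forget (Spec (.of K))).mapAut ((thickening K L).obj X)).comp ((thickening K L).mapAut X)

/-- Unfolding `thickeningMapAut`: `(R_L f).hom = (R_L f.hom).left`. [cite: GortzWedhorn2020, §(4.8)–(4.9)] -/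
@[simp]
theorem thickeningMapAut_apply_hom (X : SchemeOver K) (f : Aut X) :
    (thickeningMapAut (L := L) X f).hom = ((thickening K L).map f.hom).left := rfl

/-- `R_L f` lies over `Spec K`. [cite: GortzWedhorn2020, §(4.8)–(4.9)] -/
theorem thickeningMapAut_apply_hom_comp (X : SchemeOver K) (f : Aut X) :
    (thickeningMapAut (L := L) X f).hom ≫ ((thickening K L).obj X).hom = ((thickening K L).obj X).hom :=
  Over.w ((thickening K L).map f.hom)

/-- The Galois twists commute with `R_L f` in `Aut(X ×_K Spec L)`. [cite: GortzWedhorn2020, (14.20)] -/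
theorem commute_thickeningGalAction_thickeningMapAut (X : SchemeOver K) (σ : L ≃ₐ[K] L) (f : Aut X) :
    Commute ((thickeningGalAction X).aut σ) (thickeningMapAut (L := L) X f) := by
  refine Iso.ext ?_
  change ((thickening K L).map f.hom).left ≫ thickTwist X σ⁻¹ = thickTwist X σ⁻¹ ≫ ((thickening K L).map f.hom).left
  exact (thickTwist_comp_map_left f.hom σ⁻¹).symm

/-! ## §2 The product action -/

/-- **The product action** of `Aut(L ∕ K) × G` on `R_L X = X ×_K Spec L` over `Spec K`, for an action `ρ : G → Aut_K(X)`: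
`(σ, g) ↦ (1 × Spec σ⁻¹) · R_L(ρ g)` (the two commuting actions `thickeningGalAction` and `R_L ∘ ρ`, Mathlib `MonoidHom.noncommCoprod`).
[cite: MumfordAV1970, §7 Thm. p. 66] [cite: GortzWedhorn2020, (14.20)] -/
def thickeningProdAction (X : SchemeOver K) {G : Type*} [Group G] (ρ : G →* Aut X) :
    ActionOver ((thickening K L).obj X).hom ((L ≃ₐ[K] L) × G) where
  aut := MonoidHom.noncommCoprod (thickeningGalAction X).aut ((thickeningMapAut X).comp ρ)
    (fun σ g => commute_thickeningGalAction_thickeningMapAut X σ (ρ g))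
  aut_comp := fun a => by
    rw [MonoidHom.noncommCoprod_apply, Aut.Aut_mul_def, Iso.trans_hom, Category.assoc, (thickeningGalAction X).aut_comp,
      MonoidHom.comp_apply]
    exact thickeningMapAut_apply_hom_comp X (ρ a.2)

variable {G : Type*} [Group G] (X : SchemeOver K) (ρ : G →* Aut X)

/-- Unfolding the product action: `τ (σ, g) = (Galois twist by σ) * R_L(ρ g)` in `Aut`. [cite: GortzWedhorn2020, (14.20)] -/
theorem thickeningProdAction_aut_apply (a : (L ≃ₐ[K] L) × G) :
    (thickeningProdAction X ρ).aut a = (thickeningGalAction X).aut a.1 * thickeningMapAut (L := L) X (ρ a.2) :=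
  rfl

/-- The underlying morphism of `τ (σ, g)`: `R_L(ρ g) ≫ (1 × Spec σ⁻¹)`. [cite: GortzWedhorn2020, (14.20)] -/
theorem thickeningProdAction_aut_hom (a : (L ≃ₐ[K] L) × G) :
    ((thickeningProdAction X ρ).aut a).hom = ((thickening K L).map (ρ a.2).hom).left ≫ thickTwist X a.1⁻¹ := by
  rw [thickeningProdAction_aut_apply, Aut.Aut_mul_def, Iso.trans_hom, thickeningMapAut_apply_hom, thickeningGalAction_aut_hom]

/-- The `Aut(L ∕ K)`-part of the product action is the Galois action. [cite: GortzWedhorn2020, (14.20)] -/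
@[simp]
theorem thickeningProdAction_aut_comp_inl :
    (thickeningProdAction X ρ).aut.comp (MonoidHom.inl (L ≃ₐ[K] L) G) = (thickeningGalAction X).aut :=
  MonoidHom.noncommCoprod_comp_inl (thickeningGalAction X).aut ((thickeningMapAut X).comp ρ)
    (fun σ g => commute_thickeningGalAction_thickeningMapAut X σ (ρ g))

/-- The `G`-part of the product action is `R_L ∘ ρ`. [cite: GortzWedhorn2020, §(4.8)–(4.9)] -/
@[simp]
theorem thickeningProdAction_aut_comp_inr :
    (thickeningProdAction X ρ).aut.comp (MonoidHom.inr (L ≃ₐ[K] L) G) = (thickeningMapAut X).comp ρ :=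
  MonoidHom.noncommCoprod_comp_inr (thickeningGalAction X).aut ((thickeningMapAut X).comp ρ)
    (fun σ g => commute_thickeningGalAction_thickeningMapAut X σ (ρ g))

/-- `τ (σ, 1) = 1 × Spec σ⁻¹`. [cite: GortzWedhorn2020, (14.20)] -/
theorem thickeningProdAction_aut_inl_hom (σ : L ≃ₐ[K] L) :
    ((thickeningProdAction X ρ).aut (σ, 1)).hom = thickTwist X σ⁻¹ := by
  rw [thickeningProdAction_aut_hom, map_one]
  change ((thickening K L).map (𝟙 X)).left ≫ thickTwist X σ⁻¹ = thickTwist X σ⁻¹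
  rw [CategoryTheory.Functor.map_id]
  exact Category.id_comp _

/-- `τ (1, g) = R_L(ρ g)`. [cite: GortzWedhorn2020, §(4.8)–(4.9)] -/
theorem thickeningProdAction_aut_inr_hom (g : G) :
    ((thickeningProdAction X ρ).aut (1, g)).hom = ((thickening K L).map (ρ g).hom).left := by
  rw [thickeningProdAction_aut_hom, inv_one, thickTwist_one]
  exact Category.comp_id _

/-- Two actions over the same base with the same automorphisms are equal (the compatibility field is a proposition).
[cite: MumfordAV1970, §7 Thm. p. 66] -/
theorem _root_.Literature.AlgebraicGeometry.RelativeSpec.ActionOver.ext_of_aut_eq {X' Y' : Scheme.{u}} {r : X' ⟶ Y'}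
    {H : Type*} [Group H] {ρ₁ ρ₂ : ActionOver r H} (h : ρ₁.aut = ρ₂.aut) : ρ₁ = ρ₂ := by
  cases ρ₁; cases ρ₂; cases h; rfl

/-- The `Aut(L ∕ K)`-part of the product action, as an `ActionOver` (the literal `⟨τ.aut.comp inl, …⟩` of the P6a letter UP), IS
`thickeningGalAction X`. [cite: GortzWedhorn2020, (14.20)] -/
theorem thickeningProdAction_inl_eq_thickeningGalAction :
    (⟨(thickeningProdAction X ρ).aut.comp (MonoidHom.inl (L ≃ₐ[K] L) G),
        fun γ => (thickeningProdAction X ρ).aut_comp (MonoidHom.inl (L ≃ₐ[K] L) G γ)⟩ :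
        ActionOver ((thickening K L).obj X).hom (L ≃ₐ[K] L)) = thickeningGalAction X :=
  ActionOver.ext_of_aut_eq (thickeningProdAction_aut_comp_inl X ρ)

/-! ## §3 The outputs in the shapes of the letter UP: `_hτπ`, `_hτT`, `_hℓ` and the sheets -/

/-- **`_hτπ`**: for `L ∕ K` finite Galois, `π_X : X ×_K Spec L → X` is a geometric quotient by the `Aut(L ∕ K)`-part of the product action (★
`isGeometricQuotient_thickeningπ` transported along `thickeningProdAction_inl_eq_thickeningGalAction`; the statement is the literal shape of
the binder `_hτπ` of `RecordModuliPointwiseCoreUpstairsCofinal`). [cite: MumfordAV1970, §7 Thm. p. 66] [cite: SGA1, Exp. V Prop. 1.8] -/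
theorem isGeometricQuotient_inl_thickeningProdAction [FiniteDimensional K L] [IsGalois K L] :
    (⟨(thickeningProdAction X ρ).aut.comp (MonoidHom.inl (L ≃ₐ[K] L) G),
        fun γ => (thickeningProdAction X ρ).aut_comp (MonoidHom.inl (L ≃ₐ[K] L) G γ)⟩ :
        ActionOver ((thickening K L).obj X).hom (L ≃ₐ[K] L)).IsGeometricQuotient (thickeningπ (L := L) X).left := by
  rw [thickeningProdAction_inl_eq_thickeningGalAction]
  exact isGeometricQuotient_thickeningπ X

/-- **`_hτT`**: the `G`-part covers `ρ` through `π_X`: `τ (1, g) ≫ π_X = π_X ≫ ρ(g)`. [cite: GortzWedhorn2020, §(4.8)–(4.9)] -/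
theorem thickeningProdAction_inr_comp_π (g : G) :
    ((thickeningProdAction X ρ).aut (1, g)).hom ≫ (thickeningπ (L := L) X).left = (thickeningπ (L := L) X).left ≫ (ρ g).hom.left := by
  rw [thickeningProdAction_aut_inr_hom, thickeningπ_left, thickening_map_left_comp_fst]

/-- More generally `τ (σ, g) ≫ π_X = π_X ≫ ρ(g)` for every `σ`. [cite: GortzWedhorn2020, §(4.8)–(4.9)] -/
theorem thickeningProdAction_aut_comp_π (a : (L ≃ₐ[K] L) × G) :
    ((thickeningProdAction X ρ).aut a).hom ≫ (thickeningπ (L := L) X).left = (thickeningπ (L := L) X).left ≫ (ρ a.2).hom.left := by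
  rw [thickeningProdAction_aut_hom, thickeningπ_left, Category.assoc, thickTwist_fst, thickening_map_left_comp_fst]

/-- `τ (σ, g)` as a morphism of `R_L X` over `Spec K`. [cite: GortzWedhorn2020, (14.20)] -/
abbrev thickeningProdActionHom (a : (L ≃ₐ[K] L) × G) : (thickening K L).obj X ⟶ (thickening K L).obj X :=
  Over.homMk ((thickeningProdAction X ρ).aut a).hom ((thickeningProdAction X ρ).aut_comp a)

/-- **The action on `Ω`-points in the pair description**: `τ (σ, g) · ℓ_e P = ℓ_{e ∘ σ⁻¹} (ρ(g) · P)` — `G` acts inside each sheet through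
`ρ`, `Aut(L ∕ K)` permutes the sheets. [cite: GortzWedhorn2020, (14.20)] -/
theorem map_thickeningProdActionHom_thickeningLift {Ω : Type u} [Field Ω] [Algebra K Ω] (e : L →ₐ[K] Ω)
    (a : (L ≃ₐ[K] L) × G) (P : AlgPoints X Ω) :
    AlgPoints.map (thickeningProdActionHom X ρ a) (thickeningLift e X P) =
      thickeningLift (e.comp (a.1.symm : L →ₐ[K] L)) X (AlgPoints.map (ρ a.2).hom P) := by
  apply Over.OverMorphism.ext
  change (thickeningLift e X P).left ≫ ((thickeningProdAction X ρ).aut a).hom = _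
  rw [thickeningProdAction_aut_hom, ← Category.assoc]
  have h1 : (thickeningLift e X P).left ≫ ((thickening K L).map (ρ a.2).hom).left =
      (thickeningLift e X (AlgPoints.map (ρ a.2).hom P)).left :=
    congrArg (fun Q : AlgPoints ((thickening K L).obj X) Ω => Q.left) (map_thickening_map_thickeningLift e (ρ a.2).hom P)
  rw [h1, ← thickeningGalAction_aut_hom]
  exact aut_thickeningLift (e := e) X a.1 (AlgPoints.map (ρ a.2).hom P)

/-- In particular `τ (1, g) · ℓ_e P = ℓ_e (ρ(g) · P)`. [cite: GortzWedhorn2020, §(4.8)–(4.9)] -/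
theorem map_thickeningProdActionHom_inr_thickeningLift {Ω : Type u} [Field Ω] [Algebra K Ω] (e : L →ₐ[K] Ω) (g : G)
    (P : AlgPoints X Ω) :
    AlgPoints.map (thickeningProdActionHom X ρ (1, g)) (thickeningLift e X P) = thickeningLift e X (AlgPoints.map (ρ g).hom P) := by
  rw [map_thickeningProdActionHom_thickeningLift]
  change thickeningLift (e.comp ((1 : L ≃ₐ[K] L).symm : L →ₐ[K] L)) X _ = _
  congr 1

/-- And `τ (σ, 1) · ℓ_e P = ℓ_{e ∘ σ⁻¹} P`. [cite: GortzWedhorn2020, (14.20)] -/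
theorem map_thickeningProdActionHom_inl_thickeningLift {Ω : Type u} [Field Ω] [Algebra K Ω] (e : L →ₐ[K] Ω) (σ : L ≃ₐ[K] L)
    (P : AlgPoints X Ω) :
    AlgPoints.map (thickeningProdActionHom X ρ (σ, 1)) (thickeningLift e X P) = thickeningLift (e.comp (σ.symm : L →ₐ[K] L)) X P := by
  rw [map_thickeningProdActionHom_thickeningLift, map_one]
  change thickeningLift _ X (AlgPoints.map (𝟙 X) P) = _
  rw [AlgPoints.map_id_apply]

end Literature.AlgebraicGeometry.Motives

end
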